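import Summits.ResolutionOfSingularities.ResolutionOfSingularities.Theorems.WildConesCampaignW46HypersurfacesCharTwoIsolTransfer
import Summits.ResolutionOfSingularities.ResolutionOfSingularities.Theorems.WildConesCampaignW46HypersurfacesCharTwoFourfoldMixed

/-!
# [OURS · L1 W4.6, rung (ii) at p = 2, EVERY dimension n] `h₂ + e + 1 ≤ μ` for isolated double points, and
# THE TWO FOURFOLD WITNESSES CLASSIFIED: `u₀u₁ + u₂²u₃ + u₂u₃²` has `h₂ = 1`, `μ = 4` (three tangents),
# `u₀u₁ + u₂⁵ + u₃⁵` has `h₂ = 3` (no tangent cubic) — non-vacuity of the rev-3 predicates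
# (hypersurface double points `z² = a`, every field of characteristic 2)

HONEST FRAMING. Everything here is OURS: theorems about route WildCones' own TYPED point-blow-up
dynamics (`Theorems/WildConesClassicalRegimesDefs.lean`) with the invariants `milnorEmbDim = e` (p498937)
and `milnorHilbertTwo = h₂` (p511581). Nothing here is a statement of H. Hironaka's manuscript
[Hironaka2017] and nothing of it is used; no FACT-LIST premise. AI review is weaker than expert review.
Cell res-hironaka (LADDER-RESOLUTION rung L, D-0089), slot W4.6, seat res-L1-s46-pv-4 (gen 4); host route
`WildCones`, crux `ClassicalRegimes` (stmt-ResolutionOfSingularities-16884, proved); `--supports … --as helper`.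

WHAT IS HERE.
* `milnorHilbertTwo_add_le_mu` — for an ISOLATED double state, `h₂(c) + e(c) + 1 ≤ μ(c)` (the 3-jet
  quotient `A/𝔪_A³` of the Milnor algebra is a quotient of `A`); hence an isolated `e = 2` state has
  `μ ≥ 4`, and `μ = 4` forces `h₂ = 1` (`milnorHilbertTwo_eq_one_of_mu_le_four`).
* the colon count in `n` variables (`finrank_quot_le_of_maximalIdeal_le_colon`: adjoining `t` with
  `𝔪t ⊆ K` lowers the colength by at most one) and, with it, `μ ≤ 4` for the start series
  `u₀u₁ + u₂²u₃ + u₂u₃²` of p507619 (`(∂a) = (u₁, u₀, u₃², u₂²)`; chain `(∂a) ⊂ +u₂u₃ ⊂ +u₂ ⊂ +u₃ = 𝔪`).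
* `milnorHilbertTwo_fourMixed` (`h₂ = 1`, `μ = 4`), `milnorHilbertTwo_fourStart` (`h₂ = 3`, by the
  decided case `e = 2`: its double successor is not isolated, p485483/p507619), and
  `fourfold_hilbertTwo_witnesses`: over EVERY field of characteristic `2` the hypotheses of the rev-3
  predicates `CampaignW46HypersurfacesEmbDimTwo{ThreeTangents,Isolated,NoTangent}` /
  `…IsolStepCriterion` (p515484) are inhabited in `n = 4`, with the predicted conclusions.

References: G.-M. Greuel, G. Pfister [GreuelPfister2026] (context); H. Hironaka, ms. 2017-03-23
[Hironaka2017] — ROLE only, under adjudication, never as fact.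
-/

noncomputable section

-- single-problem summit: the doubled namespace component `ResolutionOfSingularities` is forced
set_option linter.dupNamespace false

open scoped BigOperators Classical

open MvPowerSeries IsLocalRing

open Literature.AlgebraicGeometry.Resolution

namespace Summit.ResolutionOfSingularities.ResolutionOfSingularities.Theorems

namespace CampaignW46.HypersurfacesCharTwo

open WildCones WildCones.MuDropCharTwoOrdP ThreefoldsCharTwo

variable {κ : Type} [Field κ]

/-! ## `jetThreeColength ≤ μ`: the 3-jet quotient of a finite Milnor algebra -/

/-- [OURS · L1 W4.6] For a series with FINITE Milnor algebra, `jetThreeColength f ≤ dim_κ κ⟦X⟧/(∂f)`.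
[folklore] -/
theorem jetThreeColength_le_finrank {n : ℕ} (f : MvPowerSeries (Fin n) κ)
    (hfin : Module.Finite κ (MvPowerSeries (Fin n) κ ⧸
      Ideal.span (Set.range fun s => MvPowerSeries.pderiv s f))) :
    jetThreeColength f ≤ Module.finrank κ (MvPowerSeries (Fin n) κ ⧸
      Ideal.span (Set.range fun s => MvPowerSeries.pderiv s f)) := by
  haveI := hfin
  unfold jetThreeColength
  exact Literature.RingTheory.Length.finrank_quotient_le_of_le (κ := κ) le_sup_left

section States

variable {n : ℕ}

/-- [OURS · L1 W4.6 rung (ii) at `p = 2`, every dimension; NOT a statement of the manuscript] For an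
ISOLATED double state of `z² = a(u₁,…,uₙ)` (any field of characteristic `2`): `h₂(c) + e(c) + 1 ≤ μ(c)`
— the first three Hilbert values of the Milnor algebra are bounded by its dimension. [folklore] -/
theorem milnorHilbertTwo_add_le_mu [CharP κ 2] {c : (Fin n → ℕ) → κ} (hM : MultP 2 n κ c)
    (hI : Isol 2 n κ c) :
    milnorHilbertTwo 2 n κ c + (milnorEmbDim 2 n κ c + 1) ≤ mu 2 n κ c := by
  rw [milnorHilbertTwo_add hM, mu_eq_finrank_pderiv]
  rw [isol_iff_finite_pderiv] at hI
  exact jetThreeColength_le_finrank _ hI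

/-- [OURS · L1 W4.6 rung (ii) at `p = 2`, every dimension; NOT a statement of the manuscript] An
isolated double state with `e(c) = 2` has `μ(c) ≥ 4`; if `μ(c) ≤ 4` then `μ(c) = 4` and `h₂(c) = 1`
(three distinct tangents). [folklore] -/
theorem milnorHilbertTwo_eq_one_of_mu_le_four [CharP κ 2] {c : (Fin n → ℕ) → κ} (hM : MultP 2 n κ c)
    (hI : Isol 2 n κ c) (he : milnorEmbDim 2 n κ c = 2) (hμ : mu 2 n κ c ≤ 4) :
    milnorHilbertTwo 2 n κ c = 1 ∧ mu 2 n κ c = 4 := by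
  have h1 := milnorHilbertTwo_add_le_mu hM hI
  have h2 := (milnorHilbertTwo_range hM he).1
  omega

end States

/-! ## The colon count in `n` variables -/

/-- `dim_κ κ⟦X₁,…,Xₙ⟧/𝔪 = 1`. [folklore] -/
theorem finrank_quot_maximalIdeal_eq_one (n : ℕ) :
    Module.finrank κ (MvPowerSeries (Fin n) κ ⧸ maximalIdeal (MvPowerSeries (Fin n) κ)) = 1 := by
  have e : κ ≃ₗ[κ] ResidueField (MvPowerSeries (Fin n) κ) :=
    LinearEquiv.ofBijective (Algebra.linearMap κ (ResidueField (MvPowerSeries (Fin n) κ)))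
      (bijective_algebraMap_residueField n)
  change Module.finrank κ (ResidueField (MvPowerSeries (Fin n) κ)) = 1
  rw [← e.finrank_eq, Module.finrank_self]

/-- The colon count in `n` variables: if `K` has finite colength and `𝔪 ≤ (K : t)`, then adjoining `t`
lowers the colength by at most one: `dim κ⟦X⟧/K ≤ dim κ⟦X⟧/(K + (t)) + 1`. [folklore] -/
theorem finrank_quot_le_of_maximalIdeal_le_colon {n : ℕ} {K : Ideal (MvPowerSeries (Fin n) κ)}
    [Module.Finite κ (MvPowerSeries (Fin n) κ ⧸ K)] {t : MvPowerSeries (Fin n) κ}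
    (ht : maximalIdeal (MvPowerSeries (Fin n) κ) ≤ K.colon {t}) :
    Module.finrank κ (MvPowerSeries (Fin n) κ ⧸ K) ≤
      Module.finrank κ (MvPowerSeries (Fin n) κ ⧸ (K ⊔ Ideal.span {t})) + 1 := by
  have h := Literature.RingTheory.Length.finrank_quotient_eq_colon_add (κ := κ) K t
  haveI : Module.Finite κ (MvPowerSeries (Fin n) κ ⧸ maximalIdeal (MvPowerSeries (Fin n) κ)) := by
    have := Literature.RingTheory.MvPowerSeries.Jets.finite_quotient_maximalIdeal_pow
      (σ := Fin n) (K := κ) 1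
    rwa [pow_one] at this
  have h1 := Literature.RingTheory.Length.finrank_quotient_le_of_le (κ := κ) ht
  rw [finrank_quot_maximalIdeal_eq_one] at h1
  omega

/-- `𝔪 ≤ (K : t)` as soon as `X_s t ∈ K` for every variable. [folklore] -/
theorem maximalIdeal_le_colon_of_X_mul_mem {n : ℕ} {K : Ideal (MvPowerSeries (Fin n) κ)}
    {t : MvPowerSeries (Fin n) κ} (h : ∀ s, X s * t ∈ K) :
    maximalIdeal (MvPowerSeries (Fin n) κ) ≤ K.colon {t} := by
  rw [maximalIdeal_mvPowerSeries_eq_span, Ideal.span_le]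
  rintro _ ⟨s, rfl⟩
  rw [SetLike.mem_coe, Submodule.mem_colon_singleton, smul_eq_mul]
  simpa only [mul_comm] using h s

/-! ## The fourfold witness `u₀u₁ + u₂²u₃ + u₂u₃²`: `μ ≤ 4` -/

/-- The gradient ideal of `X₀X₁ + X₂²X₃ + X₂X₃²` contains `X₀`, `X₁`, `X₂²`, `X₃²` (characteristic two).
[folklore] -/
theorem mem_jac_fourMixed [CharP κ 2] :
    (X 0 : MvPowerSeries (Fin 4) κ) ∈ Ideal.span (Set.range fun s : Fin 4 =>
        MvPowerSeries.pderiv s ((X 0 * X 1 + X 2 ^ 2 * X 3 + X 2 * X 3 ^ 2 : MvPowerSeries (Fin 4) κ))) ∧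
    (X 1 : MvPowerSeries (Fin 4) κ) ∈ Ideal.span (Set.range fun s : Fin 4 =>
        MvPowerSeries.pderiv s ((X 0 * X 1 + X 2 ^ 2 * X 3 + X 2 * X 3 ^ 2 : MvPowerSeries (Fin 4) κ))) ∧
    (X 2 : MvPowerSeries (Fin 4) κ) ^ 2 ∈ Ideal.span (Set.range fun s : Fin 4 =>
        MvPowerSeries.pderiv s ((X 0 * X 1 + X 2 ^ 2 * X 3 + X 2 * X 3 ^ 2 : MvPowerSeries (Fin 4) κ))) ∧
    (X 3 : MvPowerSeries (Fin 4) κ) ^ 2 ∈ Ideal.span (Set.range fun s : Fin 4 =>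
        MvPowerSeries.pderiv s ((X 0 * X 1 + X 2 ^ 2 * X 3 + X 2 * X 3 ^ 2 : MvPowerSeries (Fin 4) κ))) := by
  refine ⟨?_, ?_, ?_, ?_⟩
  · refine Ideal.subset_span ⟨1, ?_⟩
    simp only [pderiv_fourMixed]; simp
  · refine Ideal.subset_span ⟨0, ?_⟩
    simp only [pderiv_fourMixed]; simp
  · refine Ideal.subset_span ⟨3, ?_⟩
    simp only [pderiv_fourMixed]; simp
  · refine Ideal.subset_span ⟨2, ?_⟩
    simp only [pderiv_fourMixed]; simp

/-- [OURS · L1 W4.6] **`μ ≤ 4` for `u₀u₁ + u₂²u₃ + u₂u₃²`**: the Milnor algebra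
`κ⟦u⟧/(u₁, u₀, u₃², u₂²)` has dimension at most `4` — the chain
`(∂a) ⊆ (∂a) + (u₂u₃) ⊆ … + (u₂) ⊆ … + (u₃) = 𝔪`, each step lowering the colength by at most one
(the colon count). [folklore] -/
theorem finrank_quot_jac_fourMixed_le_four [CharP κ 2] :
    Module.finrank κ (MvPowerSeries (Fin 4) κ ⧸ Ideal.span (Set.range fun s : Fin 4 =>
      MvPowerSeries.pderiv s ((X 0 * X 1 + X 2 ^ 2 * X 3 + X 2 * X 3 ^ 2 : MvPowerSeries (Fin 4) κ)))) ≤ 4 := by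
  set J : Ideal (MvPowerSeries (Fin 4) κ) := Ideal.span (Set.range fun s : Fin 4 =>
      MvPowerSeries.pderiv s ((X 0 * X 1 + X 2 ^ 2 * X 3 + X 2 * X 3 ^ 2 : MvPowerSeries (Fin 4) κ))) with hJ
  obtain ⟨hX0, hX1, hX2, hX3⟩ := mem_jac_fourMixed (κ := κ)
  have h3 : maximalIdeal (MvPowerSeries (Fin 4) κ) ^ 3 ≤ J := maximalIdeal_pow_three_le_jac_fourMixed
  haveI hfinJ : Module.Finite κ (MvPowerSeries (Fin 4) κ ⧸ J) :=
    finite_quot_mono h3 (Literature.RingTheory.MvPowerSeries.Jets.finite_quotient_maximalIdeal_pow 3)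
  set K₁ := J ⊔ Ideal.span {(X 2 * X 3 : MvPowerSeries (Fin 4) κ)} with hK₁
  set K₂ := K₁ ⊔ Ideal.span {(X 2 : MvPowerSeries (Fin 4) κ)} with hK₂
  set K₃ := K₂ ⊔ Ideal.span {(X 3 : MvPowerSeries (Fin 4) κ)} with hK₃
  haveI : Module.Finite κ (MvPowerSeries (Fin 4) κ ⧸ K₁) := finite_quot_mono le_sup_left hfinJ
  haveI : Module.Finite κ (MvPowerSeries (Fin 4) κ ⧸ K₂) :=
    finite_quot_mono (le_sup_left.trans le_sup_left) hfinJ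
  have hXm : ∀ s : Fin 4, (X s : MvPowerSeries (Fin 4) κ) ∈ maximalIdeal (MvPowerSeries (Fin 4) κ) :=
    fun s => X_mem_maximalIdeal κ (Fin 4) s
  have hs4 : ∀ s : Fin 4, s = 0 ∨ s = 1 ∨ s = 2 ∨ s = 3 := by decide
  -- step 1: adjoin `X₂X₃` (`𝔪 · X₂X₃ ⊆ 𝔪³ ⊆ J`)
  have h1 : Module.finrank κ (MvPowerSeries (Fin 4) κ ⧸ J) ≤
      Module.finrank κ (MvPowerSeries (Fin 4) κ ⧸ K₁) + 1 := by
    refine finrank_quot_le_of_maximalIdeal_le_colon (maximalIdeal_le_colon_of_X_mul_mem fun s => h3 ?_)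
    rw [pow_three]
    exact Ideal.mul_mem_mul (hXm s) (Ideal.mul_mem_mul (hXm 2) (hXm 3))
  -- step 2: adjoin `X₂` (`X₀X₂, X₁X₂, X₂² ∈ J`, `X₃X₂ ∈ (X₂X₃)`)
  have h2 : Module.finrank κ (MvPowerSeries (Fin 4) κ ⧸ K₁) ≤
      Module.finrank κ (MvPowerSeries (Fin 4) κ ⧸ K₂) + 1 := by
    refine finrank_quot_le_of_maximalIdeal_le_colon (maximalIdeal_le_colon_of_X_mul_mem fun s => ?_)
    rcases hs4 s with rfl | rfl | rfl | rfl
    · exact Ideal.mem_sup_left (Ideal.mul_mem_right _ _ hX0)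
    · exact Ideal.mem_sup_left (Ideal.mul_mem_right _ _ hX1)
    · rw [← pow_two]
      exact Ideal.mem_sup_left hX2
    · rw [mul_comm]
      exact Ideal.mem_sup_right (Ideal.mem_span_singleton_self _)
  -- step 3: adjoin `X₃`
  have h3' : Module.finrank κ (MvPowerSeries (Fin 4) κ ⧸ K₂) ≤
      Module.finrank κ (MvPowerSeries (Fin 4) κ ⧸ K₃) + 1 := by
    refine finrank_quot_le_of_maximalIdeal_le_colon (maximalIdeal_le_colon_of_X_mul_mem fun s => ?_)
    rcases hs4 s with rfl | rfl | rfl | rfl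
    · exact Ideal.mem_sup_left (Ideal.mem_sup_left (Ideal.mul_mem_right _ _ hX0))
    · exact Ideal.mem_sup_left (Ideal.mem_sup_left (Ideal.mul_mem_right _ _ hX1))
    · exact Ideal.mem_sup_left (Ideal.mem_sup_right (Ideal.mem_span_singleton_self _))
    · rw [← pow_two]
      exact Ideal.mem_sup_left (Ideal.mem_sup_left hX3)
  -- `K₃ ⊇ 𝔪`, so its colength is `≤ 1`
  have hK₃ : maximalIdeal (MvPowerSeries (Fin 4) κ) ≤ K₃ := by
    rw [maximalIdeal_mvPowerSeries_eq_span, Ideal.span_le]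
    rintro _ ⟨s, rfl⟩
    rw [SetLike.mem_coe]
    rcases hs4 s with rfl | rfl | rfl | rfl
    · exact Ideal.mem_sup_left (Ideal.mem_sup_left (Ideal.mem_sup_left hX0))
    · exact Ideal.mem_sup_left (Ideal.mem_sup_left (Ideal.mem_sup_left hX1))
    · exact Ideal.mem_sup_left (Ideal.mem_sup_right (Ideal.mem_span_singleton_self _))
    · exact Ideal.mem_sup_right (Ideal.mem_span_singleton_self _)
  haveI : Module.Finite κ (MvPowerSeries (Fin 4) κ ⧸ maximalIdeal (MvPowerSeries (Fin 4) κ)) := by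
    have := Literature.RingTheory.MvPowerSeries.Jets.finite_quotient_maximalIdeal_pow
      (σ := Fin 4) (K := κ) 1
    rwa [pow_one] at this
  have h4 := Literature.RingTheory.Length.finrank_quotient_le_of_le (κ := κ) hK₃
  rw [finrank_quot_maximalIdeal_eq_one] at h4
  omega

/-! ## The two fourfold witnesses classified by `h₂` -/

/-- [OURS · L1 W4.6; NOT a statement of the manuscript] **`u₀u₁ + u₂²u₃ + u₂u₃²` has `h₂ = 1` and `μ = 4`**
(three distinct tangents of the residual cubic `u₂u₃(u₂ + u₃)`; the `D₄` configuration), over every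
field of characteristic `2`. [folklore] -/
theorem milnorHilbertTwo_fourMixed [CharP κ 2] {c : (Fin 4 → ℕ) → κ}
    (hc : ser 2 4 κ c = X 0 * X 1 + X 2 ^ 2 * X 3 + X 2 * X 3 ^ 2) :
    milnorHilbertTwo 2 4 κ c = 1 ∧ mu 2 4 κ c = 4 := by
  have hM := multP_of_ser_eq_fourMixed hc
  have he := fourfold_milnorEmbDim_eq_two_of_double_successor c 2 0 hM (ordP_of_ser_eq_fourMixed hc)
    (multP_step_fourMixed hc)
  refine milnorHilbertTwo_eq_one_of_mu_le_four hM (isol_of_ser_eq_fourMixed hc) he ?_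
  rw [mu_eq_finrank_pderiv, hc]
  exact finrank_quot_jac_fourMixed_le_four

/-- [OURS · L1 W4.6; NOT a statement of the manuscript] **`u₀u₁ + u₂⁵ + u₃⁵` has `h₂ = 3`** (no tangent
cubic: the residual `u₂⁵ + u₃⁵` has order `5`), over every field of characteristic `2` — read off the
decided case `e = 2`: its double successor in chart `u₂` is NOT isolated (p485483). [folklore] -/
theorem milnorHilbertTwo_fourStart [CharP κ 2] {c : (Fin 4 → ℕ) → κ}
    (hc : ser 2 4 κ c = X 0 * X 1 + X 2 ^ 5 + X 3 ^ 5) : milnorHilbertTwo 2 4 κ c = 3 := by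
  have hM := multP_of_ser_eq_fourStart hc
  have hM' := multP_step_fourStart hc
  have he := fourfold_milnorEmbDim_eq_two_of_double_successor c 2 0 hM (ordP_of_ser_eq_fourStart hc) hM'
  have hr := milnorHilbertTwo_range hM he
  have hn : ¬ milnorHilbertTwo 2 4 κ c ≤ 2 := fun hh =>
    not_isol_step_fourStart hc ((hypersurface_isol_step_iff_of_milnorEmbDim_eq_two c 2 0 hM
      (isol_of_ser_eq_fourStart hc) he hM').mpr hh)
  omega

/-- [OURS · L1 W4.6 rung (ii) at `p = 2`; NOT a statement of the manuscript] **NON-VACUITY OF THE REV-3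
PREDICATES, WITH THE PREDICTED CONCLUSIONS.** Over EVERY field of characteristic `2` there are isolated
double states of fourfold hypersurfaces (`n = 4`) with `e = 2` and a double successor (chart `u₂`, no
translation): one with `h₂ = 1`, `μ = 4`, whose successor is isolated with `μ = 1`
(`u₀u₁ + u₂²u₃ + u₂u₃²`), one with `h₂ = 3` whose successor is NOT isolated (`u₀u₁ + u₂⁵ + u₃⁵`).
[folklore] -/
theorem fourfold_hilbertTwo_witnesses (κ : Type) [Field κ] [CharP κ 2] :
    (∃ c : (Fin 4 → ℕ) → κ, MultP 2 4 κ c ∧ Isol 2 4 κ c ∧ milnorEmbDim 2 4 κ c = 2 ∧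
        milnorHilbertTwo 2 4 κ c = 1 ∧ mu 2 4 κ c = 4 ∧ MultP 2 4 κ (step 2 4 κ 2 0 c) ∧
        Isol 2 4 κ (step 2 4 κ 2 0 c) ∧ mu 2 4 κ (step 2 4 κ 2 0 c) = 1) ∧
      (∃ c : (Fin 4 → ℕ) → κ, MultP 2 4 κ c ∧ Isol 2 4 κ c ∧ milnorEmbDim 2 4 κ c = 2 ∧
        milnorHilbertTwo 2 4 κ c = 3 ∧ MultP 2 4 κ (step 2 4 κ 2 0 c) ∧ ¬ Isol 2 4 κ (step 2 4 κ 2 0 c)) := by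
  constructor
  · obtain ⟨c, hc⟩ := exists_ser_eq (κ := κ)
      ((X 0 * X 1 + X 2 ^ 2 * X 3 + X 2 * X 3 ^ 2 : MvPowerSeries (Fin 4) κ))
      fourMixed_coeff_eq_zero_of_even
    have hM := multP_of_ser_eq_fourMixed hc
    have hM' := multP_step_fourMixed hc
    have he := fourfold_milnorEmbDim_eq_two_of_double_successor c 2 0 hM (ordP_of_ser_eq_fourMixed hc) hM'
    obtain ⟨hh, hμ⟩ := milnorHilbertTwo_fourMixed hc
    have hs := hypersurface_regime_step_of_milnorHilbertTwo_eq_one c 2 0 hM he hh hM'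
    exact ⟨c, hM, isol_of_ser_eq_fourMixed hc, he, hh, hμ, hM', hs.2.1, hs.2.2⟩
  · obtain ⟨c, hc⟩ := exists_ser_eq (κ := κ)
      ((X 0 * X 1 + X 2 ^ 5 + X 3 ^ 5 : MvPowerSeries (Fin 4) κ)) fourStart_coeff_eq_zero_of_even
    have hM := multP_of_ser_eq_fourStart hc
    have hM' := multP_step_fourStart hc
    exact ⟨c, hM, isol_of_ser_eq_fourStart hc,
      fourfold_milnorEmbDim_eq_two_of_double_successor c 2 0 hM (ordP_of_ser_eq_fourStart hc) hM',
      milnorHilbertTwo_fourStart hc, hM', not_isol_step_fourStart hc⟩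

end CampaignW46.HypersurfacesCharTwo

end Summit.ResolutionOfSingularities.ResolutionOfSingularities.Theorems

end
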